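import Summits.HodgeConjecture.HodgeConjecture.Theorems.R90S6TwistedTorusFibreSum         -- TB2a FILE 2a (this seat): `lintegral_descEpsConj_comp_iwasawaExp_eq_mul_tsum`, `coe_mul_mul_qsInvolution_inv_of_diagonal`; brings ★ 1c, ★ TJ1
import Summits.HodgeConjecture.HodgeConjecture.Theorems.R90S6CartierGL                   -- ★ 1a (p01): `exists_mk_mul_eq_iff_iwasawaExp_eq_gl`; brings ★ B1 fibre lemmas `measure_setOf_mk_mul_eq(_of_not_exists)`, `measurableSet_setOf_mk_mul_eq`
import HarnessLib

/-!
# R90 · S6 «Ch. 14.1–14.5 stable TF» — CARD TB2a FILE 2 (row E1.4.4.2.1 ∕ TB2d): THE VALUE OF THE ε-TWISTED ORBITAL INTEGRAL OF A HECKE SHELL AT A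
# HYPERBOLIC-NORM `δ` — `Φ_ε(δ, 1_{K̃gK̃}) = C · J(δ) · Σ_{(n,m) ∈ ℤ²} #{γ ∈ K̃gK̃∕K̃ : e(γ) = e(δ) + (n, 2m, n)}` (`Theorems/R90S6TwistedConstantTermValue.lean`)

Cell `hodgecm-mathlib`, crux H413 (`stmt-HodgeConjecture-24833`), route of record `HCCMUnconditional`; programme R90-TF (brief `director/R90-BRIEF.v2.md`),
section S6 (base `R90-C14`), seat R90-C14-p06 (g2); dealer R90-C14-plan (g2) 02:39:30Z ∕ 02:41:15Z («TB2a FILE 2 VALUE → p06»; HEAD BYTES 02:45:43Z, heads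
(V1) (V2) (V4); (V3) = ★ FILE 2a `R90S6TwistedTorusFibreSum`).  Consumer BY NAME: R90-C14-p04 (g2)'s TB2d `R90S6TwistedHyperbolicHeckeFL` FILE B (`hTOval`).
Lane `--kind proof --supports stmt-HodgeConjecture-24833 --as helper`; THEOREMS ONLY (no definition ∕ instance ∕ notation ∕ named fact ∕ `sorry`).

THE MATHEMATICS [Rogawski1990, §4.10 (4.10.1)–Prop. 4.10.2 pp. 57–59; Kottwitz1986BaseChangeUnits §1, §3; CartierCorvallis1979 §IV (4.2)].
`K` a non-archimedean local field, `σ` a continuous involution (`≠ id`), `ε = Θ_σ` (a `MonoidHom` with `hεΘ`), `K̃ = GL₃(𝒪)`, `Ñ` upper unitriangular,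
`A` the diagonal torus, `δ = diag(d)` ε-regular (`ha`, `hb` of ★ TJ1), `T = G̃_{δε} ≤ A` closed, `μGT`, `μGA`, `μAT` invariant Radon measures on the three
coset spaces, `κ`, `μ_N` Haar — VERBATIM ★ 1c's `exists_lintegral_descEpsConj_eq_mul_lintegral_torus_gl` at `n = 3`.
* §1 (V1) **`exists_lintegral_descEpsConj_eq_mul_lintegral_torus_qsInvolution`** = ★ 1c ∘ ★ TJ1 `lintegral_twistedTorusOrbit_hJac`: the `hJac` letter is
  GONE, `J := J(δ) = (‖d₂∕d₁·σ(d₁∕d₀) − 1‖ · √‖1 − d₂∕d₀·σ(d₂∕d₀)‖)⁻¹` (= `D_G(N δ)`, ★ TJ1 HEAD 3).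
* §2 (V2) the `K̃ × Ñ` integral of a twisted-`K̃`-invariant SHELL `S = K̃ g K̃`: **`lintegral_prod_indicator_twistedConj_eq`** `= κ(K̃) · μ_N{u : m u ∈ S}`
  (the integrand does not see `k`: ★ J2′-type bi-invariance + `ε K̃ ⊆ K̃`), and **`measure_setOf_mul_mem_doubleCoset_eq`** `μ_N{u : m u ∈ K̃gK̃} =
  μ_N(Ñ₀) · #{γ ∈ K̃gK̃∕K̃ : e(γ) = e(m)}` for `m ∈ B` (the fibres over the finitely many cosets `γ` are left `Ñ₀`-cosets, hit iff `e(γ) = e(m)` — ★ B1 §1 +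
  ★ 1a `exists_mk_mul_eq_iff_iwasawaExp_eq_gl`; the `ℝ≥0∞` twin of ★ 1a `integral_indicator_doubleCoset_mul_eq_gl`).
* §3 (V4) HEAD **`exists_lintegral_descEpsConj_indicator_doubleCoset_eq_mul_tsum`**: ∃ `c ∈ (0, ∞)` (★ 1c's chain-rule constant) with, for EVERY `g`,
  `∫⁻ 1_{K̃gK̃}(y δ ε(y)⁻¹) dμGT = c · J(δ) · (κ(K̃) · μ_N(Ñ₀) · μAT(U₀)) · Σ'_{(n,m) ∈ ℤ × ℤ} #{γ ∈ K̃gK̃∕K̃ : e(γ) = e(δ) + (n, 2m, n)}`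
  (§1 + §2 at `m = a δ ε(a)⁻¹ ∈ A` + ★ FILE 2a's ε-norm fibre sum).  All `λ`-dependence (`g = ϖ^λ`) sits in the fibre COUNT (GL₃ Kostka∕Satake numbers, ★ 1a
  `coeff_satakeTransform_doubleCosetOperator_gl`), all `δ`-dependence in `J(δ)` and the fibre anchor `e(δ)`; `c · κ(K̃) · μ_N(Ñ₀) · μAT(U₀)` is ONE normalisation constant.

HONEST LABEL: the chain-rule constant `c` and the volume `μAT(U₀)` stay UNPINNED (no canonical quotient normalisation is chosen — the ★ `…CanonicalOne` road is not
entered); ε-regularity (`ha hb`) and `T ≤ A`, `T` closed (`hTA hT`) stay binders as in ★ 1c ∕ ★ TJ1; `ε K̃ ⊆ K̃` is the binder `hεK` of ★ 1b.  Count-neutral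
bookkeeping until TB2d consumes it; proves no printed statement, discharges no citation.  HC_CM is proved only modulo the 7 printed citations (2 remaining named
inputs: hLiu418 = stmt-HodgeConjecture-24832, h413 = stmt-HodgeConjecture-24833) until rung 0 closes; REL ≠ ★ ≠ BUILT.

## Tree search
★ 1c `exists_lintegral_descEpsConj_eq_mul_lintegral_torus_gl`; ★ TJ1 `lintegral_twistedTorusOrbit_hJac`; ★ FILE 2a `lintegral_descEpsConj_comp_iwasawaExp_eq_mul_tsum`,
`coe_mul_mul_qsInvolution_inv_of_diagonal`; ★ 1a `exists_mk_mul_eq_iff_iwasawaExp_eq_gl`, `integral_indicator_doubleCoset_mul_eq_gl` (Bochner twin of §2);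
★ B1 `measurableSet_setOf_mk_mul_eq`, `measure_setOf_mk_mul_eq`, `measure_setOf_mk_mul_eq_of_not_exists`; ★ `HeckeAlgebra.coe_mem_orbit_coe_iff`,
`finite_orbit_quotient`; ★ `parabolicTripleGL….le_normalizer`, `standardLeviGL_le`, `isOpen_glInt`, `isCompact_glInt`; ★ J2′ `mul_mul_mem_doubleCoset_iff` and
★ K7 `isOpen_doubleCoset_of_isOpen` live in the `Valued` frame (re-derived inline: `IsOpen.mul_right`, `DoubleCoset.mem_doubleCoset`); Mathlib `lintegral_prod_mul`,
`lintegral_indicator_one`, `measure_biUnion_finset`, `Finset.sum_ite`.  Dedup: `rg "indicator_doubleCoset_eq_mul_tsum|mul_mem_doubleCoset_eq|torus_qsInvolution"` — no hit.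

## References
* [Rogawski1990] J. D. Rogawski, *Automorphic Representations of Unitary Groups in Three Variables*, Ann. of Math. Stud. 123 (1990), §4.10 pp. 57–59.
* [Kottwitz1986BaseChangeUnits] R. Kottwitz, *Base change for unit elements of Hecke algebras*, Compositio Math. 60 (1986), §1 pp. 239–240, §3.
* [CartierCorvallis1979] P. Cartier, *Representations of 𝔭-adic groups: a survey*, PSPM 33.1 (1979), §IV (4.2) p. 146.
* [Macdonald1995] I. G. Macdonald, *Symmetric Functions and Hall Polynomials*, 2nd ed. (1995), Ch. V §2 (2.6), §3 (3.3).
-/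

set_option autoImplicit false
-- the mandated namespace repeats the single-problem summit's segment (`HodgeConjecture.HodgeConjecture`)
set_option linter.dupNamespace false

noncomputable section

open MeasureTheory Measure Set Function Filter Topology
open scoped ENNReal NNReal Pointwise MatrixGroups
open ValuativeRel MulAction Finset
open Literature.NumberTheory.Automorphic Literature.MeasureTheory.Group Literature.NumberTheory.Rogawski1990.Ch4Sec10
open Literature.NumberTheory.GaloisRepresentations Literature.NumberTheory.GaloisRepresentations.IsNonarchimedeanLocalField
open Literature.NumberTheory.Automorphic.heckeAlgebra

namespace Summit.HodgeConjecture.HodgeConjecture.R90.S6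

/-! ## §1 (V2) Hecke shells `K̃ g K̃`: twisted `K̃`-invariance, the `K̃ × Ñ` integral, and the coset count of `{u : m u ∈ K̃gK̃}` -/

section Shell

variable {K : Type*} [Field K] [ValuativeRel K] (ε : GL (Fin 3) K →* GL (Fin 3) K) (hεK : ∀ k ∈ glInt 3 K, ε k ∈ glInt 3 K)

include hεK in
/-- the Hecke shell `K̃ g K̃` is invariant under the twisted `K̃`-conjugation `x ↦ k x ε(k)⁻¹` (bi-`K̃`-invariance + `ε K̃ ⊆ K̃`; the `Valued`-frame twin is ★ J2′
`twistedConj_mem_doubleCoset_iff`). [cite: Kottwitz1986BaseChangeUnits, §1 p. 239] -/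
theorem twistedConj_mem_doubleCoset_iff_gl (g : GL (Fin 3) K) {k : GL (Fin 3) K} (hk : k ∈ glInt 3 K) (x : GL (Fin 3) K) :
    k * x * (ε k)⁻¹ ∈ (glInt 3 K : Set (GL (Fin 3) K)) * {g} * (glInt 3 K : Set (GL (Fin 3) K)) ↔
      x ∈ (glInt 3 K : Set (GL (Fin 3) K)) * {g} * (glInt 3 K : Set (GL (Fin 3) K)) := by
  have hk' : (ε k)⁻¹ ∈ glInt 3 K := (glInt 3 K).inv_mem (hεK k hk)
  change k * x * (ε k)⁻¹ ∈ DoubleCoset.doubleCoset g (glInt 3 K : Set (GL (Fin 3) K)) (glInt 3 K) ↔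
    x ∈ DoubleCoset.doubleCoset g (glInt 3 K : Set (GL (Fin 3) K)) (glInt 3 K)
  rw [DoubleCoset.mem_doubleCoset, DoubleCoset.mem_doubleCoset]
  constructor
  · rintro ⟨k₁, hk₁, k₂, hk₂, e⟩
    refine ⟨k⁻¹ * k₁, (glInt 3 K).mul_mem ((glInt 3 K).inv_mem hk) hk₁, k₂ * ε k, (glInt 3 K).mul_mem hk₂ (hεK k hk), ?_⟩
    calc x = k⁻¹ * (k * x * (ε k)⁻¹) * ε k := by group
      _ = k⁻¹ * k₁ * g * (k₂ * ε k) := by rw [e]; group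
  · rintro ⟨k₁, hk₁, k₂, hk₂, rfl⟩
    exact ⟨k * k₁, (glInt 3 K).mul_mem hk hk₁, k₂ * (ε k)⁻¹, (glInt 3 K).mul_mem hk₂ hk', by group⟩

/-- `x ∈ K̃ g K̃ ↔ xK̃ ∈ K̃·(gK̃)` (the shell as a set versus the orbit in `G ⧸ K̃`, ★ `coe_mem_orbit_coe_iff`). [cite: Macdonald1995, Ch. V §2 (2.6)] -/
theorem mem_doubleCoset_iff_coe_mem_orbit (g x : GL (Fin 3) K) :
    x ∈ (glInt 3 K : Set (GL (Fin 3) K)) * {g} * (glInt 3 K : Set (GL (Fin 3) K)) ↔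
      (x : GL (Fin 3) K ⧸ glInt 3 K) ∈ MulAction.orbit (glInt 3 K) (g : GL (Fin 3) K ⧸ glInt 3 K) := by
  change x ∈ DoubleCoset.doubleCoset g (glInt 3 K : Set (GL (Fin 3) K)) (glInt 3 K) ↔ _
  rw [DoubleCoset.mem_doubleCoset, coe_mem_orbit_coe_iff]
  simp only [SetLike.mem_coe]

end Shell

section Inner

variable {K : Type*} [Field K] [ValuativeRel K] [TopologicalSpace K] [IsNonarchimedeanLocalField K]
  [MeasurableSpace (GL (Fin 3) K)] [BorelSpace (GL (Fin 3) K)]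
  (ε : GL (Fin 3) K →* GL (Fin 3) K) (hεK : ∀ k ∈ glInt 3 K, ε k ∈ glInt 3 K)

omit [MeasurableSpace (GL (Fin 3) K)] [BorelSpace (GL (Fin 3) K)] in
/-- the Hecke shell `K̃ g K̃` is open (hence Borel): `GL₃(𝒪)` is open ★ `isOpen_glInt` (the `Valued`-frame twin is ★ K7 `isOpen_doubleCoset_of_isOpen`).
[cite: Kottwitz1986BaseChangeUnits, §1 p. 239] -/
theorem isOpen_doubleCoset_glInt (g : GL (Fin 3) K) : IsOpen ((glInt 3 K : Set (GL (Fin 3) K)) * {g} * (glInt 3 K : Set (GL (Fin 3) K))) :=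
  ((isOpen_glInt 3 K).mul_right).mul_right

include hεK in
/-- **(V2a) THE `K̃ × Ñ` INTEGRAL OF A SHELL DOES NOT SEE `k`**: `∫⁻_{K̃×Ñ} 1_S(k (m n) ε(k)⁻¹) d(κ ⊗ μ_N) = κ(K̃) · μ_N{n : m n ∈ S}` for `S = K̃ g K̃`, any s-finite
`κ`, `μ_N` (Mathlib `lintegral_prod_mul`, `lintegral_indicator_one`). [cite: Rogawski1990, §4.10 p. 57; §4.13 p. 70] -/
theorem lintegral_prod_indicator_twistedConj_eq (g m : GL (Fin 3) K) (κ : Measure ↥(glInt 3 K)) [SFinite κ]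
    (μN : Measure ↥(upperUnitriangular (Fin 3) K)) [SFinite μN] :
    ∫⁻ q : ↥(glInt 3 K) × ↥(upperUnitriangular (Fin 3) K),
        ((glInt 3 K : Set (GL (Fin 3) K)) * {g} * (glInt 3 K : Set (GL (Fin 3) K))).indicator (1 : GL (Fin 3) K → ℝ≥0∞)
          ((q.1 : GL (Fin 3) K) * (m * (q.2 : GL (Fin 3) K)) * (ε (q.1 : GL (Fin 3) K))⁻¹) ∂(κ.prod μN) =
      κ Set.univ * μN {u | m * (u : GL (Fin 3) K) ∈ (glInt 3 K : Set (GL (Fin 3) K)) * {g} * (glInt 3 K : Set (GL (Fin 3) K))} := by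
  haveI : BorelSpace ↥(upperUnitriangular (Fin 3) K) := Subtype.borelSpace _
  set S : Set (GL (Fin 3) K) := (glInt 3 K : Set (GL (Fin 3) K)) * {g} * (glInt 3 K : Set (GL (Fin 3) K)) with hS
  have hmeasS : MeasurableSet {u : ↥(upperUnitriangular (Fin 3) K) | m * (u : GL (Fin 3) K) ∈ S} :=
    ((isOpen_doubleCoset_glInt g).preimage (continuous_const.mul continuous_subtype_val)).measurableSet
  have hpt : ∀ q : ↥(glInt 3 K) × ↥(upperUnitriangular (Fin 3) K),
      S.indicator (1 : GL (Fin 3) K → ℝ≥0∞) ((q.1 : GL (Fin 3) K) * (m * (q.2 : GL (Fin 3) K)) * (ε (q.1 : GL (Fin 3) K))⁻¹) =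
        1 * ({u : ↥(upperUnitriangular (Fin 3) K) | m * (u : GL (Fin 3) K) ∈ S}).indicator (1 : ↥(upperUnitriangular (Fin 3) K) → ℝ≥0∞) q.2 := by
    intro q
    rw [one_mul]
    by_cases hq : m * (q.2 : GL (Fin 3) K) ∈ S
    · rw [Set.indicator_of_mem ((twistedConj_mem_doubleCoset_iff_gl ε hεK g q.1.2 _).2 hq),
        Set.indicator_of_mem (show q.2 ∈ {u : ↥(upperUnitriangular (Fin 3) K) | m * (u : GL (Fin 3) K) ∈ S} from hq)]
      rfl
    · rw [Set.indicator_of_notMem (fun h => hq ((twistedConj_mem_doubleCoset_iff_gl ε hεK g q.1.2 _).1 h)),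
        Set.indicator_of_notMem (show q.2 ∉ {u : ↥(upperUnitriangular (Fin 3) K) | m * (u : GL (Fin 3) K) ∈ S} from hq)]
  simp_rw [hpt]
  rw [lintegral_prod_mul aemeasurable_const ((measurable_one.indicator hmeasS).aemeasurable), lintegral_const, one_mul, lintegral_indicator_one hmeasS]

/-- **(V2b) THE COSET COUNT: `μ_N{u : m u ∈ K̃gK̃} = μ_N(Ñ₀) · #{γ ∈ K̃gK̃∕K̃ : e(γ) = e(m)}`** for `m` in the Borel subgroup (it normalises `Ñ`) and any left-invariant `μ_N`:
the set is the disjoint union over the finitely many cosets `γ ⊂ K̃gK̃` of the fibres `{u : (m u)K̃ = γ}`, each a left `Ñ₀`-coset (★ B1 `measure_setOf_mk_mul_eq`) hit iff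
`e(γ) = e(m)` (★ 1a `exists_mk_mul_eq_iff_iwasawaExp_eq_gl`) — the `ℝ≥0∞` twin of ★ 1a `integral_indicator_doubleCoset_mul_eq_gl`.
[cite: CartierCorvallis1979, §IV (4.2) p. 146] [cite: Macdonald1995, Ch. V §2 (2.6)] -/
theorem measure_setOf_mul_mem_doubleCoset_eq [IsDiscreteValuationRing 𝒪[K]] {ϖ : K} (hϖ : IsUniformizingElement ϖ)
    [IsHeckeTriple (⊤ : Submonoid (GL (Fin 3) K)) (glInt 3 K) (glInt 3 K)]
    (μN : Measure ↥(upperUnitriangular (Fin 3) K)) [μN.IsMulLeftInvariant]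
    (g : GL (Fin 3) K) {m : GL (Fin 3) K} (hm : m ∈ standardParabolicGL K (_root_.id : Fin 3 → Fin 3)) :
    μN {u | m * (u : GL (Fin 3) K) ∈ (glInt 3 K : Set (GL (Fin 3) K)) * {g} * (glInt 3 K : Set (GL (Fin 3) K))} =
      μN {u : ↥(upperUnitriangular (Fin 3) K) | (u : GL (Fin 3) K) ∈ glInt 3 K} *
        (#((finite_orbit_quotient (glInt 3 K) g).toFinset.filter fun γ => iwasawaExp hϖ γ.out = iwasawaExp hϖ m) : ℝ≥0∞) := by
  classical
  haveI : T2Space K := (isLocalField K).toT2Space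
  haveI : SecondCountableTopology K := secondCountableTopology_localField K
  haveI : SecondCountableTopology (Matrix (Fin 3) (Fin 3) K) := inferInstanceAs (SecondCountableTopology (Fin 3 → Fin 3 → K))
  haveI : SecondCountableTopology (Matrix (Fin 3) (Fin 3) K)ᵐᵒᵖ := MulOpposite.opHomeomorph.symm.secondCountableTopology
  haveI : SecondCountableTopology (GL (Fin 3) K) := Units.isEmbedding_embedProduct.secondCountableTopology
  haveI : BorelSpace ↥(upperUnitriangular (Fin 3) K) := Subtype.borelSpace _
  haveI : SecondCountableTopology ↥(upperUnitriangular (Fin 3) K) := TopologicalSpace.Subtype.secondCountableTopology _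
  haveI : MeasurableMul ↥(upperUnitriangular (Fin 3) K) := inferInstance
  have ht : m ∈ Subgroup.normalizer (upperUnitriangular (Fin 3) K : Set (GL (Fin 3) K)) :=
    (parabolicTripleGL K (_root_.id : Fin 3 → Fin 3)).le_normalizer hm
  have hN₀ : MeasurableSet {u : ↥(upperUnitriangular (Fin 3) K) | (u : GL (Fin 3) K) ∈ glInt 3 K} :=
    ((isOpen_glInt 3 K).preimage continuous_subtype_val).measurableSet
  set s := (finite_orbit_quotient (glInt 3 K) g).toFinset with hs
  -- the set as a finite disjoint union of fibres
  have hunion : {u : ↥(upperUnitriangular (Fin 3) K) | m * (u : GL (Fin 3) K) ∈ (glInt 3 K : Set (GL (Fin 3) K)) * {g} * (glInt 3 K : Set (GL (Fin 3) K))} =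
      ⋃ γ ∈ s, {u : ↥(upperUnitriangular (Fin 3) K) | ((m * u : GL (Fin 3) K) : GL (Fin 3) K ⧸ glInt 3 K) = γ} := by
    ext u
    simp only [Set.mem_setOf_eq, Set.mem_iUnion, hs, Set.Finite.mem_toFinset, exists_prop, exists_eq_right']
    exact mem_doubleCoset_iff_coe_mem_orbit g _
  have hdisj : Set.PairwiseDisjoint (↑s : Set (GL (Fin 3) K ⧸ glInt 3 K))
      (fun γ => {u : ↥(upperUnitriangular (Fin 3) K) | ((m * u : GL (Fin 3) K) : GL (Fin 3) K ⧸ glInt 3 K) = γ}) := by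
    intro γ _ γ' _ hne
    refine Set.disjoint_left.2 fun u hu hu' => hne ?_
    rw [Set.mem_setOf_eq] at hu hu'
    rw [← hu, ← hu']
  rw [hunion, measure_biUnion_finset hdisj (fun γ _ => measurableSet_setOf_mk_mul_eq m γ hN₀)]
  -- each fibre: `μ(Ñ₀)` if hit (iff `e(γ) = e(m)`), else `0`
  have hfib : ∀ γ : GL (Fin 3) K ⧸ glInt 3 K,
      μN {u : ↥(upperUnitriangular (Fin 3) K) | ((m * u : GL (Fin 3) K) : GL (Fin 3) K ⧸ glInt 3 K) = γ} =
        if iwasawaExp hϖ γ.out = iwasawaExp hϖ m then μN {u : ↥(upperUnitriangular (Fin 3) K) | (u : GL (Fin 3) K) ∈ glInt 3 K} else 0 := by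
    intro γ
    by_cases h : ∃ u₀ : ↥(upperUnitriangular (Fin 3) K), ((m * u₀ : GL (Fin 3) K) : GL (Fin 3) K ⧸ glInt 3 K) = γ
    · obtain ⟨u₀, hu₀⟩ := h
      rw [measure_setOf_mk_mul_eq μN m hu₀, if_pos ((exists_mk_mul_eq_iff_iwasawaExp_eq_gl hϖ ht γ).1 ⟨u₀, hu₀⟩)]
    · rw [measure_setOf_mk_mul_eq_of_not_exists μN m h, if_neg (fun h' => h ((exists_mk_mul_eq_iff_iwasawaExp_eq_gl hϖ ht γ).2 h'))]
  simp_rw [hfib]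
  rw [Finset.sum_ite, Finset.sum_const_zero, add_zero, Finset.sum_const, nsmul_eq_mul, mul_comm]

end Inner

/-! ## §2 (V1) The twisted torus descent with the Jacobian PAID (`hJac := ★ TJ1`), and §3 (V4) THE VALUE -/

section Value

variable {K : Type*} [Field K] [ValuativeRel K] [TopologicalSpace K] [IsNonarchimedeanLocalField K] [MeasurableSpace K] [BorelSpace K]
  [IsDiscreteValuationRing 𝒪[K]] {ϖ : K} (hϖ : IsUniformizingElement ϖ)
  [MeasurableSpace (GL (Fin 3) K)] [BorelSpace (GL (Fin 3) K)]
  (σ : K →+* K) (hσ : ∀ x, σ (σ x) = x) (hσc : Continuous σ)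
  (ε : GL (Fin 3) K →* GL (Fin 3) K) (hε : Continuous ε) (hεΘ : ∀ g, ε g = UnitaryGroup.qsInvolution σ g)
  (hεK : ∀ k ∈ glInt 3 K, ε k ∈ glInt 3 K)
  (δ : GL (Fin 3) K) (d : Fin 3 → K) (hδ : (δ : Matrix (Fin 3) (Fin 3) K) = Matrix.diagonal d)

omit [IsDiscreteValuationRing 𝒪[K]] in
include hσ hσc hε hεΘ hδ in
/-- **(V1) THE ε-TWISTED TORUS DESCENT WITH TJ1'S JACOBIAN** (★ 1c `exists_lintegral_descEpsConj_eq_mul_lintegral_torus_gl` ∘ ★ TJ1 `lintegral_twistedTorusOrbit_hJac`):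
ONE `c ∈ (0, ∞)` such that for every Borel `F ≥ 0`,
`∫⁻_{G̃ ⧸ T} F(y δ ε(y)⁻¹) dμGT = c · J(δ) · ∫⁻_{A ⧸ T} ∫⁻_{K̃×Ñ} F(k ((a δ ε(a)⁻¹) n) ε(k)⁻¹) d(κ ⊗ μ_N) dμAT(a)`, `J(δ) = (‖d₂∕d₁·σ(d₁∕d₀) − 1‖ · √‖1 − d₂∕d₀·σ(d₂∕d₀)‖)⁻¹`.
[cite: Rogawski1990, §4.10 Prop. 4.10.2 proof p. 59; §4.13 p. 70] [cite: Kottwitz1986BaseChangeUnits, §1 pp. 239–240] -/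
theorem exists_lintegral_descEpsConj_eq_mul_lintegral_torus_qsInvolution (hσ1 : ∃ x, σ x ≠ x)
    (ha : d 2 / d 1 * σ (d 1 / d 0) - 1 ≠ 0) (hb : 1 - d 2 / d 0 * σ (d 2 / d 0) ≠ 0)
    {A : Subgroup (GL (Fin 3) K)} (hAid : A = standardLeviGL K (_root_.id : Fin 3 → Fin 3))
    (hT : IsClosed (epsCentralizer ε δ : Set (GL (Fin 3) K))) (hTA : epsCentralizer ε δ ≤ A)
    [MeasurableSpace (GL (Fin 3) K ⧸ epsCentralizer ε δ)] [BorelSpace (GL (Fin 3) K ⧸ epsCentralizer ε δ)]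
    [MeasurableSpace (GL (Fin 3) K ⧸ A)] [BorelSpace (GL (Fin 3) K ⧸ A)]
    [MeasurableSpace (↥A ⧸ (epsCentralizer ε δ).subgroupOf A)] [BorelSpace (↥A ⧸ (epsCentralizer ε δ).subgroupOf A)]
    (μGT : Measure (GL (Fin 3) K ⧸ epsCentralizer ε δ)) [SMulInvariantMeasure (GL (Fin 3) K) (GL (Fin 3) K ⧸ epsCentralizer ε δ) μGT]
    [IsFiniteMeasureOnCompacts μGT] (hGT : μGT ≠ 0)
    (μGA : Measure (GL (Fin 3) K ⧸ A)) [SMulInvariantMeasure (GL (Fin 3) K) (GL (Fin 3) K ⧸ A) μGA] [IsFiniteMeasureOnCompacts μGA] (hGA : μGA ≠ 0)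
    (μAT : Measure (↥A ⧸ (epsCentralizer ε δ).subgroupOf A)) [SMulInvariantMeasure ↥A (↥A ⧸ (epsCentralizer ε δ).subgroupOf A) μAT]
    [IsFiniteMeasureOnCompacts μAT] (hAT : μAT ≠ 0)
    (κ : Measure ↥(glInt 3 K)) [IsHaarMeasure κ] (μN : Measure ↥(upperUnitriangular (Fin 3) K)) [IsHaarMeasure μN] :
    ∃ c : ℝ≥0∞, c ≠ 0 ∧ c ≠ ∞ ∧ ∀ (Fn : GL (Fin 3) K → ℝ≥0∞), Measurable Fn →
      ∫⁻ y, descEpsConj ε δ (epsCentralizer ε δ) Fn y ∂μGT =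
        c * ((((normAbs K (d 2 / d 1 * σ (d 1 / d 0) - 1))⁻¹ * (NNReal.sqrt (normAbs K (1 - d 2 / d 0 * σ (d 2 / d 0))))⁻¹ : ℝ≥0)) : ℝ≥0∞) *
          ∫⁻ z, descEpsConj ε δ (epsCentralizer ε δ)
            (fun m => ∫⁻ q : ↥(glInt 3 K) × ↥(upperUnitriangular (Fin 3) K),
              Fn ((q.1 : GL (Fin 3) K) * (m * (q.2 : GL (Fin 3) K)) * (ε (q.1 : GL (Fin 3) K))⁻¹) ∂(κ.prod μN))
            (inclQuot (epsCentralizer ε δ) A z) ∂μAT := by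
  obtain ⟨c, hc, hc', key⟩ := exists_lintegral_descEpsConj_eq_mul_lintegral_torus_gl ε hε δ hAid hT hTA μGT hGT μGA hGA μAT hAT κ μN
  refine ⟨c, hc, hc', fun Fn hFn => ?_⟩
  have hJac : ∀ a : ↥A, ∀ Φ : GL (Fin 3) K → ℝ≥0∞, Measurable Φ →
      ∫⁻ u, Φ ((u : GL (Fin 3) K) * ((a : GL (Fin 3) K) * δ * (ε (a : GL (Fin 3) K))⁻¹) * (ε (u : GL (Fin 3) K))⁻¹) ∂μN =
        ((((normAbs K (d 2 / d 1 * σ (d 1 / d 0) - 1))⁻¹ * (NNReal.sqrt (normAbs K (1 - d 2 / d 0 * σ (d 2 / d 0))))⁻¹ : ℝ≥0)) : ℝ≥0∞) *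
          ∫⁻ u, Φ (((a : GL (Fin 3) K) * δ * (ε (a : GL (Fin 3) K))⁻¹) * (u : GL (Fin 3) K)) ∂μN := by
    intro a Φ hΦ
    simp only [hεΘ]
    exact lintegral_twistedTorusOrbit_hJac σ hσ hσc hσ1 δ d hδ ha hb μN hAid a Φ hΦ
  rw [key hJac Fn hFn, mul_assoc]

omit [ValuativeRel K] [TopologicalSpace K] [IsNonarchimedeanLocalField K] [MeasurableSpace K] [BorelSpace K] [IsDiscreteValuationRing 𝒪[K]]
  [MeasurableSpace (GL (Fin 3) K)] [BorelSpace (GL (Fin 3) K)] in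
/-- `descEpsConj ε δ G_{δε} φ (g G_{δε}) = φ(g δ ε(g)⁻¹)` (local copy of ★ 1c's private lemma). [cite: Rogawski1990, §1.6 p. 5] -/
private theorem descEpsConj_apply_mk'' {α : Type*} (φ : GL (Fin 3) K → α) (g : GL (Fin 3) K) :
    descEpsConj ε δ (epsCentralizer ε δ) φ (QuotientGroup.mk g : GL (Fin 3) K ⧸ epsCentralizer ε δ) = φ (g * δ * (ε g)⁻¹) := by
  obtain ⟨m, hm⟩ := QuotientGroup.mk_out_eq_mul (epsCentralizer ε δ) g
  have hmδ : (m : GL (Fin 3) K) * δ * (ε (m : GL (Fin 3) K))⁻¹ = δ := (mem_epsCentralizer_iff ε δ _).1 m.2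
  unfold descEpsConj
  rw [hm, map_mul]
  congr 1
  calc g * (m : GL (Fin 3) K) * δ * (ε g * ε (m : GL (Fin 3) K))⁻¹ = g * ((m : GL (Fin 3) K) * δ * (ε (m : GL (Fin 3) K))⁻¹) * (ε g)⁻¹ := by group
    _ = g * δ * (ε g)⁻¹ := by rw [hmδ]

include hϖ hσ hσc hε hεΘ hεK hδ in
/-- **(V4) THE VALUE OF THE ε-TWISTED ORBITAL INTEGRAL OF A HECKE SHELL AT A HYPERBOLIC-NORM `δ`** — p04's `hTOval` letter.  In the frame of ★ 1c at `n = 3`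
(`ε = Θ_σ` via `hεΘ`, `ε K̃ ⊆ K̃` via `hεK`, `δ = diag(d)` ε-regular, `T = G̃_{δε} ≤ A` closed, invariant Radon `μGT μGA μAT`, Haar `κ μ_N`): there is ONE
`c ∈ (0, ∞)` (★ 1c's chain-rule constant) such that FOR EVERY `g ∈ GL₃(K)`, with `S = K̃ g K̃`, `J(δ) = (‖d₂∕d₁·σ(d₁∕d₀) − 1‖ · √‖1 − d₂∕d₀·σ(d₂∕d₀)‖)⁻¹`
(★ TJ1), `U₀ = {z : e(a_z δ ε(a_z)⁻¹) = e(δ)}` (★ FILE 2a) and `e = iwasawaExp hϖ`,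
**`∫⁻ 1_S(y δ ε(y)⁻¹) dμGT(y) = c · J(δ) · (κ(K̃) · μ_N(Ñ₀) · μAT(U₀)) · Σ'_{(n,m) ∈ ℤ × ℤ} #{γ ∈ K̃gK̃ ∕ K̃ : e(γ) = e(δ) + (n, 2m, n)}`** — the twisted constant
term of the shell summed over the ε-NORM FIBRE through `e(δ)` (§1 + §2 at the diagonal points `a δ ε(a)⁻¹` + ★ FILE 2a `lintegral_descEpsConj_comp_iwasawaExp_eq_mul_tsum`).
[cite: Rogawski1990, §4.10 (4.10.1) p. 57, Prop. 4.10.2 proof p. 59] [cite: Kottwitz1986BaseChangeUnits, §1 pp. 239–240, §3] [cite: CartierCorvallis1979, §IV (4.2) p. 146] -/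
theorem exists_lintegral_descEpsConj_indicator_doubleCoset_eq_mul_tsum (hσ1 : ∃ x, σ x ≠ x)
    [IsHeckeTriple (⊤ : Submonoid (GL (Fin 3) K)) (glInt 3 K) (glInt 3 K)]
    (ha : d 2 / d 1 * σ (d 1 / d 0) - 1 ≠ 0) (hb : 1 - d 2 / d 0 * σ (d 2 / d 0) ≠ 0)
    {A : Subgroup (GL (Fin 3) K)} (hAid : A = standardLeviGL K (_root_.id : Fin 3 → Fin 3))
    (hT : IsClosed (epsCentralizer ε δ : Set (GL (Fin 3) K))) (hTA : epsCentralizer ε δ ≤ A)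
    [MeasurableSpace (GL (Fin 3) K ⧸ epsCentralizer ε δ)] [BorelSpace (GL (Fin 3) K ⧸ epsCentralizer ε δ)]
    [MeasurableSpace (GL (Fin 3) K ⧸ A)] [BorelSpace (GL (Fin 3) K ⧸ A)]
    [MeasurableSpace (↥A ⧸ (epsCentralizer ε δ).subgroupOf A)] [BorelSpace (↥A ⧸ (epsCentralizer ε δ).subgroupOf A)]
    (μGT : Measure (GL (Fin 3) K ⧸ epsCentralizer ε δ)) [SMulInvariantMeasure (GL (Fin 3) K) (GL (Fin 3) K ⧸ epsCentralizer ε δ) μGT]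
    [IsFiniteMeasureOnCompacts μGT] (hGT : μGT ≠ 0)
    (μGA : Measure (GL (Fin 3) K ⧸ A)) [SMulInvariantMeasure (GL (Fin 3) K) (GL (Fin 3) K ⧸ A) μGA] [IsFiniteMeasureOnCompacts μGA] (hGA : μGA ≠ 0)
    (μAT : Measure (↥A ⧸ (epsCentralizer ε δ).subgroupOf A)) [SMulInvariantMeasure ↥A (↥A ⧸ (epsCentralizer ε δ).subgroupOf A) μAT]
    [IsFiniteMeasureOnCompacts μAT] (hAT : μAT ≠ 0)
    (κ : Measure ↥(glInt 3 K)) [IsHaarMeasure κ] (μN : Measure ↥(upperUnitriangular (Fin 3) K)) [IsHaarMeasure μN] :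
    ∃ c : ℝ≥0∞, c ≠ 0 ∧ c ≠ ∞ ∧ ∀ g : GL (Fin 3) K,
      ∫⁻ y, descEpsConj ε δ (epsCentralizer ε δ)
          (((glInt 3 K : Set (GL (Fin 3) K)) * {g} * (glInt 3 K : Set (GL (Fin 3) K))).indicator (1 : GL (Fin 3) K → ℝ≥0∞)) y ∂μGT =
        c * ((((normAbs K (d 2 / d 1 * σ (d 1 / d 0) - 1))⁻¹ * (NNReal.sqrt (normAbs K (1 - d 2 / d 0 * σ (d 2 / d 0))))⁻¹ : ℝ≥0)) : ℝ≥0∞) *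
          (κ Set.univ * μN {u : ↥(upperUnitriangular (Fin 3) K) | (u : GL (Fin 3) K) ∈ glInt 3 K} *
            μAT {z | descEpsConj ε δ (epsCentralizer ε δ) (fun m => iwasawaExp hϖ m) (inclQuot (epsCentralizer ε δ) A z) = iwasawaExp hϖ δ}) *
          ∑' p : ℤ × ℤ, (#((finite_orbit_quotient (glInt 3 K) g).toFinset.filter
            fun γ => iwasawaExp hϖ γ.out = iwasawaExp hϖ δ + ![p.1, 2 * p.2, p.1]) : ℝ≥0∞) := by
  haveI : T2Space K := (isLocalField K).toT2Space
  haveI : SecondCountableTopology K := secondCountableTopology_localField K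
  haveI : LocallyCompactSpace K := (isLocalField K).toLocallyCompactSpace
  haveI : SecondCountableTopology (Matrix (Fin 3) (Fin 3) K) := inferInstanceAs (SecondCountableTopology (Fin 3 → Fin 3 → K))
  haveI : SecondCountableTopology (Matrix (Fin 3) (Fin 3) K)ᵐᵒᵖ := MulOpposite.opHomeomorph.symm.secondCountableTopology
  haveI : SecondCountableTopology (GL (Fin 3) K) := Units.isEmbedding_embedProduct.secondCountableTopology
  haveI : LocallyCompactSpace (Matrix (Fin 3) (Fin 3) K) := inferInstanceAs (LocallyCompactSpace (Fin 3 → Fin 3 → K))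
  haveI : LocallyCompactSpace (GL (Fin 3) K) := inferInstance
  haveI : BorelSpace ↥(glInt 3 K) := Subtype.borelSpace _
  haveI : BorelSpace ↥(upperUnitriangular (Fin 3) K) := Subtype.borelSpace _
  haveI : CompactSpace ↥(glInt 3 K) := isCompact_iff_compactSpace.1 (isCompact_glInt 3 K)
  haveI : IsFiniteMeasure κ := CompactSpace.isFiniteMeasure
  haveI : SecondCountableTopology ↥(upperUnitriangular (Fin 3) K) := TopologicalSpace.Subtype.secondCountableTopology _
  haveI : LocallyCompactSpace ↥(upperUnitriangular (Fin 3) K) := (isClosed_upperUnitriangular (R := K) (n := 3)).locallyCompactSpace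
  haveI : SFinite μN := inferInstance
  obtain ⟨c, hc, hc', key⟩ := exists_lintegral_descEpsConj_eq_mul_lintegral_torus_qsInvolution σ hσ hσc ε hε hεΘ δ d hδ hσ1 ha hb hAid hT hTA
    μGT hGT μGA hGA μAT hAT κ μN
  refine ⟨c, hc, hc', fun g => ?_⟩
  set S : Set (GL (Fin 3) K) := (glInt 3 K : Set (GL (Fin 3) K)) * {g} * (glInt 3 K : Set (GL (Fin 3) K)) with hS
  have hSmeas : Measurable (S.indicator (1 : GL (Fin 3) K → ℝ≥0∞)) := measurable_one.indicator (isOpen_doubleCoset_glInt g).measurableSet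
  rw [key _ hSmeas]
  -- the inner `K̃ × Ñ` integral at the diagonal points `a δ ε(a)⁻¹`
  set G : (Fin 3 → ℤ) → ℝ≥0∞ := fun v => (#((finite_orbit_quotient (glInt 3 K) g).toFinset.filter fun γ => iwasawaExp hϖ γ.out = v) : ℝ≥0∞) with hG
  have hmemA : ∀ a : ↥A, (a : GL (Fin 3) K) ∈ standardLeviGL K (_root_.id : Fin 3 → Fin 3) := fun a => hAid ▸ a.2
  have hpt_mem : ∀ a : ↥A, (a : GL (Fin 3) K) * δ * (ε (a : GL (Fin 3) K))⁻¹ ∈ standardParabolicGL K (_root_.id : Fin 3 → Fin 3) := by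
    intro a
    refine standardLeviGL_le K (_root_.id : Fin 3 → Fin 3) ((mem_standardLeviGL_iff (_root_.id : Fin 3 → Fin 3) _).2 fun i j hij => ?_)
    have hα : ((a : GL (Fin 3) K) : Matrix (Fin 3) (Fin 3) K) = Matrix.diagonal fun i => ((a : GL (Fin 3) K) : Matrix (Fin 3) (Fin 3) K) i i := by
      ext i j
      by_cases hij : i = j
      · subst hij; rw [Matrix.diagonal_apply_eq]
      · rw [Matrix.diagonal_apply_ne _ hij]
        exact (mem_standardLeviGL_iff (_root_.id : Fin 3 → Fin 3) _).1 (hmemA a) i j hij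
    rw [hεΘ, coe_mul_mul_qsInvolution_inv_of_diagonal σ hα hδ]
    exact Matrix.diagonal_apply_ne _ hij
  have hinner : ∀ z : ↥A ⧸ (epsCentralizer ε δ).subgroupOf A,
      descEpsConj ε δ (epsCentralizer ε δ)
          (fun m => ∫⁻ q : ↥(glInt 3 K) × ↥(upperUnitriangular (Fin 3) K),
            S.indicator (1 : GL (Fin 3) K → ℝ≥0∞) ((q.1 : GL (Fin 3) K) * (m * (q.2 : GL (Fin 3) K)) * (ε (q.1 : GL (Fin 3) K))⁻¹) ∂(κ.prod μN))
          (inclQuot (epsCentralizer ε δ) A z) =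
        (κ Set.univ * μN {u : ↥(upperUnitriangular (Fin 3) K) | (u : GL (Fin 3) K) ∈ glInt 3 K}) *
          descEpsConj ε δ (epsCentralizer ε δ) (fun m => G (iwasawaExp hϖ m)) (inclQuot (epsCentralizer ε δ) A z) := by
    intro z
    induction z using QuotientGroup.induction_on with
    | H a =>
      simp only [inclQuot_mk, descEpsConj_apply_mk'' ε δ]
      rw [lintegral_prod_indicator_twistedConj_eq ε hεK g _ κ μN, measure_setOf_mul_mem_doubleCoset_eq hϖ μN g (hpt_mem a)]
      simp only [hG, mul_assoc]
  simp_rw [hinner]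
  rw [lintegral_const_mul' _ _ (ENNReal.mul_ne_top (measure_ne_top κ _) ?_),
    lintegral_descEpsConj_comp_iwasawaExp_eq_mul_tsum hϖ σ hσ hσc ε hε hεΘ δ d hδ hAid hTA μAT G]
  · simp only [hG]
    ring
  · -- `μ_N(Ñ₀) < ∞`: `Ñ₀ = Ñ ∩ K̃` is compact
    have hcpt : IsCompact {u : ↥(upperUnitriangular (Fin 3) K) | (u : GL (Fin 3) K) ∈ glInt 3 K} :=
      Topology.IsClosedEmbedding.subtypeVal (isClosed_upperUnitriangular (R := K) (n := 3)) |>.isCompact_preimage (isCompact_glInt 3 K)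
    exact hcpt.measure_lt_top.ne

end Value

end Summit.HodgeConjecture.HodgeConjecture.R90.S6

end
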